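import Summits.MatrixMultiplication.MatrixMultiplication.Theorems.AbelianSTPPCensusVPCertGainTable

/-!
# vP certificate, deltas Δ3 + Δ4: the `VPCert` checker (definitions)

Crux `ShapeExclusionVP337` (route `AbelianSTPPCensusVP`, item stmt-MatrixMultiplication-19191), orders `128 ≤ M ≤ 337`.
A FORK of eng-2's verified lineage-B checker `ShapeCert` (`…Theorems.AbelianSTPPCensusShapeCertDefs`, crux
`ShapeExclusionTE`, orders `≤ 127`) — every `ShapeCert` definition is reused by import, none is edited — with the vP
deltas of HOME/mm-stpp-plan/routeVP3-g7/CERTIFICATE-DESIGN.md §6–§7.2 (REF [104]/[106]):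
* Δ1 — member records carry the extended integer gains `gainOf337` (`⌈10⁶·V^{5/6}⌉`, `V ≤ 337`);
* order — the universe is walked by LARGEST SIDE DESCENDING (`lev := max(a,b,c)` is the binning key), and the
  candidate pool is decorated, next to eng-2's per-bucket ratio maxima `B8`, with the per-letter SUFFIX MAXIMA of
  the sides (`Dec.ma/mb/mc`; lemma `sufDec_side` in the soundness file) — rider D-R1, order-agnostic: no property
  of the order is used by the soundness proof;
* Δ3 — every DFS node (a prefix that passed eng-2's hereditary admissibility test `feasP`, rule set vM) is first
  tested for a violation of rule U11-G (any order) or U11-P (prime orders) in each of the three letter forms and, if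
  KILLED, explored no further (`killG`/`killP`: exact integer search over the only `t` that can violate,
  `2 ≤ t ≤ (U−M)/2` resp. `1 ≤ t < U−M`, `U = Σab+Σbc+Σca`, since the ceiling is at least `t·(M − P₃)`);
  soundness = heredity of U11-G/U11-P (`ShapeCert.u11GM_of_le` / `u11PM_of_le`, p440210);
* Δ4 — the continuation packing budget `q0` of eng-2 (U14 budget ∧ ½·U11 budget) is sharpened to
  `min q0 q_bud`, `q_bud = min_t ⌊3·Bud_t/(3t − m)⌋` over gated `t` (`t > ` every middle letter of the prefix AND of
  the remaining pool, `3 ≤ t ≤ min(T_r, L_r)`), `Bud_t = 2t² + tM + ΣV − tU − 1` (REF [73] CLAIM (*) =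
  `VPBudget.u11G_budget_core`, p427390; at prime orders the Pollard budget `t² + tp + ΣV − tU`, `1 ≤ t ≤ T_r`), `m` =
  the pool's largest side (`3V ≤ m·(ab+bc+ca)` for every later member).  Rule R6 (U11♯) is NOT ported (D-R2).
`checkV M = true` is turned into the crux at order `M` by `…VPCertSound` (`VPCert.checkV_sound`) — this file holds
definitions only; no residual lists (the vP census has no survivor at any order `128 ≤ M ≤ 337`).
Cell mm-stpp, seat mm-stpp-vp-p2 (gen 0), 2026-08-26.
-/

set_option linter.dupNamespace false -- `MatrixMultiplication.MatrixMultiplication` (summit = problem, D-0017)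
set_option autoImplicit false

namespace Summit.MatrixMultiplication.MatrixMultiplication.Theorems.VPCert

open ShapeCert

/-! ### Records, universe (largest side descending), decoration -/

/-- The member record of `(a,b,c)` at order `M`: eng-2's `mkSh` with the Δ1 gain `gainOf337 (abc)` (and the ratio
`rho` computed from it) and binning key `lev := max a (max b c)`. -/
def mkShV (M a b c : ℕ) : Sh :=
  let g := gainOf337 (a * b * c)
  { a := a, b := b, c := c, V := a * b * c, ab := a * b, bc := b * c, ca := c * a,
    wA := a * (b + c), wB := b * (c + a), wC := c * (a + b), g := g,
    mpp := max (a * b) (max (b * c) (c * a)),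
    dab := a * b * c - a * b + (if hasLCD (a * b * c) M c then 0 else 1),
    dbc := a * b * c - b * c + (if hasLCD (a * b * c) M a then 0 else 1),
    dca := a * b * c - c * a + (if hasLCD (a * b * c) M b then 0 else 1),
    rho := g * K / (a * b + b * c + c * a) + 1,
    lev := max a (max b c) }

/-- The record of a triple. -/
def shOfV (M : ℕ) (x : ℕ × ℕ × ℕ) : Sh := mkShV M x.1 x.2.1 x.2.2

/-- The universe of member shapes at order `M` (eng-2's static membership test `inUnivB`), generation order. -/
def univ0V (M : ℕ) : List Sh :=
  (List.range M).flatMap fun a' => (List.range (M / (a' + 1))).flatMap fun b' =>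
    (List.range (M / ((a' + 1) * (b' + 1)))).filterMap fun c' =>
      if inUnivB M (a' + 1) (b' + 1) (c' + 1) then (mkShV M (a' + 1) (b' + 1) (c' + 1)).force some else none

/-- The universe distributed into `M + 1` bins by largest side. -/
def binsV (M : ℕ) : List (List Sh) :=
  (univ0V M).foldl (fun bs s => addBin bs s.lev s) (List.replicate (M + 1) [])

/-- The universe in the VP walk order: largest side descending. -/
def univV (M : ℕ) : List Sh := ((binsV M).reverse).flatten

/-- Decoration of a pool position: eng-2's bucket vector of suffix maxima of `rho`, and the suffix maxima of the
three sides `a`, `b`, `c` over the pool. -/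
structure Dec where
  /-- suffix maxima of `rho` per volume bucket -/
  (B : B8)
  /-- suffix maxima of the sides -/
  (ma mb mc : ℕ)

/-- Decoration at the head of a decorated pool (zero for the empty pool). -/
def headD : List (Sh × Dec) → Dec
  | [] => ⟨B8.zero, 0, 0, 0⟩
  | (_, d) :: _ => d

/-- the largest side anywhere in the pool -/
def Dec.ms (d : Dec) : ℕ := max d.ma (max d.mb d.mc)

/-- Decorate a shape list with the suffix maxima (all entries evaluated). -/
def sufDec : List Sh → List (Sh × Dec)
  | [] => []
  | s :: rest =>
    let r := sufDec rest
    let d := headD r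
    seqN (bmax s d.B 0) fun v0 => seqN (bmax s d.B 1) fun v1 => seqN (bmax s d.B 2) fun v2 =>
    seqN (bmax s d.B 3) fun v3 => seqN (bmax s d.B 4) fun v4 => seqN (bmax s d.B 5) fun v5 =>
    seqN (bmax s d.B 6) fun v6 => seqN (bmax s d.B 7) fun v7 =>
    seqN (max s.a d.ma) fun ma => seqN (max s.b d.mb) fun mb => seqN (max s.c d.mc) fun mc =>
      (s, ⟨⟨v0, v1, v2, v3, v4, v5, v6, v7⟩, ma, mb, mc⟩) :: r

section aggregates
/-! ### The vP aggregates of a prefix (newest member first) -/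

variable (fam : List Sh)

/-- `Σ V` -/
def svL : ℕ := (fam.map (·.V)).sum
/-- fibre sum of form A (middle letter `a`): `Σ a · min(c, b)` -/
def laL : ℕ := (fam.map fun s => s.a * min s.c s.b).sum
/-- fibre sum of form B (middle letter `b`): `Σ b · min(a, c)` -/
def lbL : ℕ := (fam.map fun s => s.b * min s.a s.c).sum
/-- fibre sum of form C (middle letter `c`): `Σ c · min(b, a)` -/
def lcL : ℕ := (fam.map fun s => s.c * min s.b s.a).sum
/-- largest `a` in the prefix -/
def mxaL : ℕ := (fam.map (·.a)).foldr max 0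
/-- largest `b` in the prefix -/
def mxbL : ℕ := (fam.map (·.b)).foldr max 0
/-- largest `c` in the prefix -/
def mxcL : ℕ := (fam.map (·.c)).foldr max 0

end aggregates

/-- eng-2's aggregate record extended by the vP aggregates. -/
structure AggV where
  /-- eng-2's aggregates (gains, U11 weights, pair-product sums, U14 offsets, maxima, minima) -/
  (A : Agg)
  /-- `Σ V`, the three fibre sums, the three per-letter maxima -/
  (sv la lb lc mxa mxb mxc : ℕ)

/-- The aggregate record of a prefix. -/
def aggV (M : ℕ) (fam : List Sh) : AggV :=
  ⟨aggOf M fam, svL fam, laL fam, lbL fam, lcL fam, mxaL fam, mxbL fam, mxcL fam⟩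

/-- Evaluate all fields, then continue. -/
def AggV.force {α : Sort*} (P : AggV) (f : AggV → α) : α :=
  P.A.force fun A => seqN P.sv fun sv => seqN P.la fun la => seqN P.lb fun lb => seqN P.lc fun lc =>
    seqN P.mxa fun mxa => seqN P.mxb fun mxb => seqN P.mxc fun mxc => f ⟨A, sv, la, lb, lc, mxa, mxb, mxc⟩

/-- `AggV.force` is evaluation order only. -/
@[simp] theorem AggV.force_eq {α : Sort*} (P : AggV) (f : AggV → α) : P.force f = f P := by
  cases P; simp [AggV.force]

/-- Aggregates of the prefix extended by `t`. -/
def AggV.push (P : AggV) (t : Sh) : AggV :=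
  ⟨P.A.push t, t.V + P.sv, t.a * min t.c t.b + P.la, t.b * min t.a t.c + P.lb, t.c * min t.b t.a + P.lc,
    max t.a P.mxa, max t.b P.mxb, max t.c P.mxc⟩

/-! ### Δ3: exact node kills by U11-G / U11-P (three letter forms) -/

section kills
variable (f : List Sh) (t : ℕ)

/-- ceiling head `Σ a c · min(t, b)` (form B) -/
def ubB' : ℕ := (f.map fun s => s.a * s.c * min t s.b).sum
/-- ceiling head of form A (letters `(c,a,b)`): `Σ c b · min(t, a)` -/
def ubA' : ℕ := (f.map fun s => s.c * s.b * min t s.a).sum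
/-- ceiling head of form C (letters `(b,c,a)`): `Σ b a · min(t, c)` -/
def ubC' : ℕ := (f.map fun s => s.b * s.a * min t s.c).sum
/-- fibre count `L_B(t) = Σ_{b < t} b · min(a, c)` -/
def flB : ℕ := (f.map fun s => if s.b < t then s.b * min s.a s.c else 0).sum
/-- fibre count of form A: `Σ_{a < t} a · min(c, b)` -/
def flA : ℕ := (f.map fun s => if s.a < t then s.a * min s.c s.b else 0).sum
/-- fibre count of form C: `Σ_{c < t} c · min(b, a)` -/
def flC : ℕ := (f.map fun s => if s.c < t then s.c * min s.b s.a else 0).sum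

end kills

/-- U11-G (one form) is violated at `t`: `P1, P2` the form's two pair-product sums, `P3` the third, `ub` the
ceiling head, `fl` the fibre count (the negation of the body of `ShapeCert.U11GFormBM` at this `t`). -/
def violG (M P1 P2 P3 ub fl t : ℕ) : Bool :=
  decide (2 ≤ t) && decide (t ≤ P1) && decide (t ≤ P2) && decide (t ≤ fl) &&
    ((t == 2 && decide (ub + 2 * (M - P3) + 4 < 2 * (P1 + P2))) ||
      (decide (3 ≤ t) && decide (ub + t * (M - P3) + 2 * t ^ 2 < t * (P1 + P2) + 1)))

/-- U11-P (one form, prime order `p`) is violated at `t` (the negation of the body of `ShapeCert.U11PFormBM`). -/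
def violP (p P1 P2 P3 ub t : ℕ) : Bool :=
  decide (1 ≤ t) && decide (t ≤ P1) && decide (t ≤ P2) && decide (ub + t * (p - P3) < t * min p (P1 + P2 - t))

/-- The prefix `f` with (eng-2) aggregates `P` violates U11-G in some letter form.  Only `2 ≤ t ≤ (U − M)/2` can
violate (`U = Σab + Σbc + Σca`; the ceiling is at least `t·(M − P3)`), so the search is exact and short. -/
def killG (M : ℕ) (P : Agg) (f : List Sh) : Bool :=
  let U := P.sab + P.sbc + P.sca
  decide (M + 2 < U) &&
    seqN (max 1 ((U - M) / 2 - 1)) fun n =>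
      (List.range' 2 n).any (fun t => violG M P.sab P.sbc P.sca (ubB' f t) (flB f t) t) ||
      (List.range' 2 n).any (fun t => violG M P.sca P.sab P.sbc (ubA' f t) (flA f t) t) ||
      (List.range' 2 n).any (fun t => violG M P.sbc P.sca P.sab (ubC' f t) (flC f t) t)

/-- The prefix violates U11-P (prime order `M`) in some letter form; only `1 ≤ t < U − M` can violate. -/
def killP (M : ℕ) (P : Agg) (f : List Sh) : Bool :=
  let U := P.sab + P.sbc + P.sca
  decide (M + 1 < U) &&
    seqN (U - M - 1) fun n =>
      (List.range' 1 n).any (fun t => violP M P.sab P.sbc P.sca (ubB' f t) t) ||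
      (List.range' 1 n).any (fun t => violP M P.sca P.sab P.sbc (ubA' f t) t) ||
      (List.range' 1 n).any (fun t => violP M P.sbc P.sca P.sab (ubC' f t) t)

/-- The node kill: U11-G at every order, U11-P in addition when `isP` (the order is prime). -/
def killV (M : ℕ) (isP : Bool) (P : Agg) (f : List Sh) : Bool := killG M P f || (isP && killP M P f)

/-! ### Δ4: the U11-G / U11-P completion budget -/

/-- The sampled thresholds `t` (besides the least admissible one of each form). -/
def tset : List ℕ := [4, 5, 6, 7, 8, 10, 12, 14, 16, 19, 23, 27, 32, 45, 64, 91, 128, 181, 256]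

section budget
variable (P : AggV) (d : Dec) (M : ℕ)

/-- `U = Σab + Σbc + Σca` of the prefix -/
def AggV.U : ℕ := P.A.sab + P.A.sbc + P.A.sca
/-- least `t` of the U11-G budget in form A: `t ≥ 3` and `t >` every `a` of the prefix and of the pool -/
def AggV.tloA : ℕ := max (max P.mxa d.ma) 2 + 1
/-- least `t` of the U11-G budget in form B -/
def AggV.tloB : ℕ := max (max P.mxb d.mb) 2 + 1
/-- least `t` of the U11-G budget in form C -/
def AggV.tloC : ℕ := max (max P.mxc d.mc) 2 + 1
/-- largest `t` of the U11-G budget in form A: `t ≤ min(Σca, Σab)` and `t ≤ L_A` -/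
def AggV.thiA : ℕ := min (min P.A.sca P.A.sab) P.la
/-- largest `t` of the U11-G budget in form B: `t ≤ min(Σab, Σbc)` and `t ≤ L_B` -/
def AggV.thiB : ℕ := min (min P.A.sab P.A.sbc) P.lb
/-- largest `t` of the U11-G budget in form C: `t ≤ min(Σbc, Σca)` and `t ≤ L_C` -/
def AggV.thiC : ℕ := min (min P.A.sbc P.A.sca) P.lc
/-- `t` is admissible for the U11-G budget in some form, and the pool's sides are below `3t` -/
def AggV.tokG (t : ℕ) : Bool :=
  decide (d.ms < 3 * t) &&
    (decide (P.tloA d ≤ t ∧ t ≤ P.thiA) || decide (P.tloB d ≤ t ∧ t ≤ P.thiB) || decide (P.tloC d ≤ t ∧ t ≤ P.thiC))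
/-- `t` is admissible for the U11-P budget in some form: `t >` the form's middle letters, `1 ≤ t ≤ T_r` -/
def AggV.tokP (t : ℕ) : Bool :=
  decide (d.ms < 3 * t) &&
    (decide (max P.mxa d.ma + 1 ≤ t ∧ t ≤ min P.A.sca P.A.sab) || decide (max P.mxb d.mb + 1 ≤ t ∧ t ≤ min P.A.sab P.A.sbc) ||
      decide (max P.mxc d.mc + 1 ≤ t ∧ t ≤ min P.A.sbc P.A.sca))
/-- packing budget of the continuation from the U11-G core at `t`: `⌊3·(2t² + tM + ΣV − tU − 1)/(3t − m)⌋` -/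
def AggV.qG1 (t : ℕ) : ℕ := 3 * (2 * t ^ 2 + t * M + P.sv - (t * P.U + 1)) / (3 * t - d.ms)
/-- packing budget of the continuation from the U11-P core at `t` (prime order): `⌊3·(t² + tM + ΣV − tU)/(3t − m)⌋` -/
def AggV.qP1 (t : ℕ) : ℕ := 3 * (t ^ 2 + t * M + P.sv - t * P.U) / (3 * t - d.ms)
/-- the candidate thresholds at this node -/
def AggV.tcands : List ℕ := P.tloA d :: P.tloB d :: P.tloC d :: (max P.mxa d.ma + 1) :: (max P.mxb d.mb + 1) ::
  (max P.mxc d.mc + 1) :: tset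
/-- the combined packing budget of any admissible continuation: eng-2's `q0`, sharpened by every gated budget -/
def AggV.qTot (isP : Bool) : ℕ :=
  (P.tcands d).foldl (fun q t =>
    if isP then (if P.tokP d t then min q (P.qP1 d M t) else q)
    else (if P.tokG d t then min q (P.qG1 d M t) else q)) (P.A.q0 M)

end budget

section node
variable (A : Agg) (M q : ℕ)

/-- the volume bucket every further member fits into, for the packing budget `q` (eng-2's `kOf` with `q0 ↦ q`) -/
def kOfq : ℕ := min (bucketOf (A.vl M)) (min (kU q) (kR (min (A.ra M) (min (A.rb M) (A.rc M)))))
/-- continuation bound (scaled by `K`) for the packing budget `q` and bucket vector `B` -/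
def bndq (B : B8) : ℕ := if A.dead M then 0 else B.get (kOfq A M q) * q

end node

/-- One DFS level (eng-2's `loop`, with the sharpened packing budget `q`): walk the pool; stop when even the best
remaining ratio cannot make the branch beat; skip candidates over the U11 budgets or the volume cap; descend into every
extension that passes eng-2's hereditary admissibility test `feasA` (the pool of the extension starts at the chosen
shape — repetitions allowed). -/
def loopV (M : ℕ) (rec : List Sh → List (Sh × Dec) → Bool) (fam : List Sh) (P : AggV)
    (ra rb rc vl g0 q : ℕ) (sel : B8 → ℕ) (mdk : ℕ) : List (Sh × Dec) → Bool
  | [] => true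
  | (t, d) :: rest =>
    if g0 + sel d.B * q ≤ mdk then true
    else if ra < t.wA ∨ rb < t.wB ∨ rc < t.wC ∨ vl < t.V then loopV M rec fam P ra rb rc vl g0 q sel mdk rest
    else
      (if feasA M t P.A fam then rec (t :: fam) ((t, d) :: rest) else true) &&
      loopV M rec fam P ra rb rc vl g0 q sel mdk rest

/-- The DFS with fuel: a prefix killed by U11-G / U11-P has no vP-admissible super-multiset (explored no
further); otherwise a beating prefix refutes the certificate (no residual lists); a dead prefix has no extensions; otherwise the node constants (U11
budgets, volume cap, the vP packing budget `qTot` from the decoration at the head of the pool, the bucket) are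
evaluated once and the pool is walked. -/
def dfsV (M : ℕ) (isP : Bool) : ℕ → List Sh → List (Sh × Dec) → Bool
  | 0, _, _ => false
  | n + 1, fam, L =>
    (aggV M fam).force fun P =>
      if killV M isP P.A fam then true
      else if M * D < P.A.gs then false
      else if P.A.dead M then true
      else
        seqN (P.A.ra M) fun ra => seqN (P.A.rb M) fun rb => seqN (P.A.rc M) fun rc => seqN (P.A.vl M) fun vl =>
        seqN (P.A.gs * K) fun g0 => seqN (P.qTot (headD L) M isP) fun q => seqN (kOfq P.A M q) fun k =>
        seqN (M * D * K) fun mdk =>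
          loopV M (dfsV M isP n) fam P ra rb rc vl g0 q (selOf k) mdk L

/-- The vP certificate checker at order `M` (the primality flag is evaluated once). -/
def checkV (M : ℕ) : Bool :=
  bif decide (Nat.Prime M) then dfsV M true (M + 2) [] (sufDec (univV M))
  else dfsV M false (M + 2) [] (sufDec (univV M))

end Summit.MatrixMultiplication.MatrixMultiplication.Theorems.VPCert
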